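import Literature.NumberTheory.Automorphic.ArchEndoscopicCartanAtlas       -- ★ p849525 LH3-p03 (g2) (T-ATLAS) PART 1: `endoTorus L S c ∈ H_∞`, `endoBlock`, `endoCircle`, `hypBlockGL`, block matrices, `continuous_endoTorus`
import Literature.NumberTheory.Automorphic.UnitaryGroupArchTopology         -- ★ instances `LocallyCompactSpace` ∕ `SecondCountableTopology` ∕ `T2Space` on `arch …`
import Literature.MeasureTheory.Group.InvariantQuotientExistence             -- ★ `quotientMeasure M t ν` (Deitmar–Echterhoff Thm. 1.5.3: the quotient measure `dν ∕ dt` on `G ⧸ M`)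
import Literature.MeasureTheory.Group.InvariantQuotientConjugacySum          -- ★ `descConj γ M _ f : G ⧸ M → E`, the orbital integrand `y M ↦ f (y γ y⁻¹)`
import Mathlib.MeasureTheory.Measure.Haar.Unique
import HarnessLib

/-!
# The chart tori of `H_∞ = U(Φ₂)(L⁺ ⊗ ℝ) × U(Φ₁)(L⁺ ⊗ ℝ)`, their Haar measures, and the chart orbital functionals `chartOrbH`
# ((T-MEAS) of the LH3 direct road: Rogawski 1990 §3.6, §4.9, §8.2–8.3; Shelstad 1979 §4; Deitmar–Echterhoff 2014 Thm. 1.5.3; Folland 1995 §2.6)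

Topic `NumberTheory/Automorphic`; namespace `Literature.NumberTheory.Automorphic.UnitaryGroup`.  DEFINITIONS WITH BODIES (`endoTorusHom`, `chartTorusH`, `chartBox`,
`chartBoxImg`, `chartHaarH`, `chartQuotientMeasureH`, `chartOrbH`) + theorems; no instance, no notation, no axiom, no named fact, no `sorry`.  Cell `pub/hodgecm-mathlib`,
crux H413 (`stmt-HodgeConjecture-24833`), F0∕P3c line LH3 (closer stub `stub_N9`, DIRECT ROAD); organ «(T-MEAS)» of LH3-plan (g2)'s PACK-SPEC v1 §1 «CURRENCY DECISION»
(2026-09-02T05:41:42Z; rulings D1∕D3 «=» 05:52:08Z, (δ3) 05:52:31Z), dealt to LH2-p04 (g3).  Imported by the D2-pack (`stOrbFamH`, LH3-p01) and (CUR) (LH3-p02); count-neutral.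

* §1 The (T-ATLAS) chart `c ↦ endoTorus L S c ∈ H_∞` (★ p849525) is a continuous GROUP HOMOMORPHISM from the additive coordinates `W → Fin 3 → ℝ` (all three slots are
  exponentials): `endoTorus_zero ∕ _add ∕ _neg ∕ _sub ∕ _comm`, packaged as `endoTorusHom S : Multiplicative (W → Fin 3 → ℝ) →* H_∞`.
* §2 **`chartTorusH S : Subgroup H_∞`** := the topological closure of the range of `endoTorusHom S` (D1: the range IS closed — a Cartan subgroup, `= Z(endoTorus S c)` at
  regular `c`, sibling THEOREMS file — so this IS the range; the closure only makes `IsClosed`, the hypothesis of ★ `quotientMeasure`, definitional):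
  `isClosed_chartTorusH`, `endoTorus_mem_chartTorusH`, **`chartTorusH_le_centralizer`** (for EVERY `c`), **`forall_mem_chartTorusH_comm`** (the ★ `descConj` binder at every
  chart point), `chartTorusH_mul_comm`, `locallyCompactSpace_chartTorusH`, `continuous_descConj_endoTorus`; the closed coordinate box `chartBox S` (`x ∈ [0,1]`, angles
  `∈ [0, 2π]`) and its compact image `chartBoxImg S = B_S ⊆ T_S` (`1 ∈ B_S`).
* §3 **`chartHaarH S`** := an AUXILIARY Haar measure on `T_S` (Mathlib `haarMeasure` at a fixed positive compact): `isHaarMeasure_`, `regular_`, `isMulLeftInvariant_`,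
  `isFiniteMeasureOnCompacts_`, `isOpenPosMeasure_`, **`isInvInvariant_chartHaarH`** (abelian ⇒ inversion invariant) — the four binders of ★ `quotientMeasure` —, `dt_S(B_S) < ∞`.
* §4 **`chartQuotientMeasureH νH S`** := ★ `quotientMeasure (chartTorusH S) (chartHaarH S) _ νH` on `H_∞ ⧸ T_S` (Borel σ-algebra fixed INSIDE, D3) and
  **`chartOrbH νH S fH c := dt_S(B_S) · ∫ y, fH (y · endoTorus S c · y⁻¹) d(dνH ∕ dt_S)(ȳ)`** (★ `descConj`; ruling (δ3): the box-mass prefactor makes the functional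
  INDEPENDENT of the auxiliary Haar measure — `t ↦ κ t` scales `dt(B_S)` by `κ` and the quotient measure by `κ⁻¹`), defined at EVERY `c`; `chartOrbH_def` (rfl),
  `chartOrbH_congr` (depends on `c` only through the chart point ⇒ (P) of the D2-pack is the atlas's periodicity), `chartOrbH_zero`.  Binders: `H_∞`'s σ-algebra and
  `νH`'s `IsFiniteMeasureOnCompacts ∕ IsMulRightInvariant` only, so `stOrbFamH νH fH S c := archRH S c · Σ_ε chartOrbH νH S fH (ε • c)` is a plain function of `c`.
NOT HERE (sibling THEOREMS file `ArchEndoscopicChartTorusRange`): closed range (`chartTorusH S =` range), `0 < dt_S(B_S)` (Baire), `chartOrbH_eq_of_isHaarMeasure`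
(Haar-freeness); the `G′`-side twin `chartTorusG ∕ chartOrbG` over (T-ATLAS) PART 2b `gprimeTorus` with the SAME box (coherent by construction); the (CUR) junction
(LH3-p02); the realised-Weyl invariance `chartOrbH_negXAt`.  HONEST LABEL: HC_CM is proved only modulo the 7 printed citations (2 remaining: hLiu418 =
`stmt-HodgeConjecture-24832`, h413 = `stmt-HodgeConjecture-24833`) until rung 0 closes; chart∕measure bookkeeping, moves no row of the books.

## References
* [Rogawski1990] J. D. Rogawski, *Automorphic Representations of Unitary Groups in Three Variables*, Ann. of Math. Stud. 123 (1990), §3.6 p. 31, §4.9 p. 54, §8.2–8.3 pp. 122–124.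
* [Shelstad1979] D. Shelstad, *Characters and inner forms of a quasi-split group over ℝ*, Compositio Math. 39 (1979), §4 pp. 22–23 (`T`, `dt`, `Φ^T_f`).
* [DeitmarEchterhoff2014] A. Deitmar, S. Echterhoff, *Principles of Harmonic Analysis*, 2nd ed. (2014), Thm. 1.5.3 (quotient integral formula).
* [Folland1995] G. B. Folland, *A Course in Abstract Harmonic Analysis* (1995), §2.2 (Haar measure), §2.6 Thm. 2.49, (2.52).
-/

set_option autoImplicit false

noncomputable section

open MeasureTheory MeasureTheory.Measure NumberField NumberField.InfinitePlace Matrix Complex Topology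
open Literature.MeasureTheory.Group
open scoped MatrixGroups Matrix Classical

namespace Literature.NumberTheory.Automorphic.UnitaryGroup

/-! ## §1 The chart is a group homomorphism in the coordinates -/

section Hom

/-- `diag(e^{0}, e^{0}) = 1`. [cite: Rogawski1990, §3.6 p. 31] -/
theorem hypBlockGL_zero : hypBlockGL 0 0 = 1 := by
  refine Matrix.GeneralLinearGroup.ext fun i j => ?_
  rw [coe_hypBlockGL, Units.val_one]
  fin_cases i <;> fin_cases j <;> simp

/-- **The split block is additive in `(x, θ)`**: `diag(e^{(x+x′)+i(θ+θ′)}, e^{−(x+x′)+i(θ+θ′)}) = diag(e^{x+iθ}, e^{−x+iθ}) · diag(e^{x′+iθ′}, e^{−x′+iθ′})`.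
[cite: Rogawski1990, §3.6 p. 31] -/
theorem hypBlockGL_add (x x' θ θ' : ℝ) : hypBlockGL (x + x') (θ + θ') = hypBlockGL x θ * hypBlockGL x' θ' := by
  refine Matrix.GeneralLinearGroup.ext fun i j => ?_
  rw [Units.val_mul, coe_hypBlockGL, coe_hypBlockGL, coe_hypBlockGL]
  fin_cases i <;> fin_cases j <;>
    simp only [Matrix.mul_apply, Fin.sum_univ_two, Fin.zero_eta, Fin.isValue, Fin.mk_one, of_apply, cons_val', cons_val_zero, cons_val_one,
      empty_val', cons_val_fin_one, mul_zero, zero_mul, add_zero, zero_add, ← Complex.exp_add] <;>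
    push_cast <;> ring_nf

variable (L : Type) [Field L]

/-- **The `U(Φ₂)_w`-block of the chart is additive in the coordinates** (split place: `hypBlockGL_add`; compact place: the Cayley conjugate of the diagonal circle
hom, `Circle.exp_add`). [cite: Rogawski1990, §3.6 p. 31; §8.2 p. 122] -/
theorem endoBlock_add (S : Finset {w : InfinitePlace L // IsComplex w}) (c c' : {w : InfinitePlace L // IsComplex w} → Fin 3 → ℝ)
    (w : {w : InfinitePlace L // IsComplex w}) : endoBlock L S (c + c') w = endoBlock L S c w * endoBlock L S c' w := by
  apply Subtype.ext
  rw [Subgroup.coe_mul]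
  by_cases hw : w ∈ S
  · unfold endoBlock
    rw [if_pos hw, if_pos hw, if_pos hw]
    simp only [Pi.add_apply]
    exact hypBlockGL_add _ _ _ _
  · unfold endoBlock
    rw [if_neg hw, if_neg hw, if_neg hw]
    have hz : (![Circle.exp ((c + c') w 0), Circle.exp ((c + c') w 2)] : Fin 2 → Circle) =
        ![Circle.exp (c w 0), Circle.exp (c w 2)] * ![Circle.exp (c' w 0), Circle.exp (c' w 2)] := by
      funext i
      fin_cases i <;> simp [Pi.add_apply, Circle.exp_add]
    simp only [hz, map_mul]
    group

/-- **The `U(Φ₁)_w`-entry `e^{iφ}` is additive in `φ`.** [cite: Rogawski1990, §4.9 p. 54] -/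
theorem endoCircle_add (c c' : {w : InfinitePlace L // IsComplex w} → Fin 3 → ℝ) (w : {w : InfinitePlace L // IsComplex w}) :
    endoCircle L (c + c') w = endoCircle L c w * endoCircle L c' w := by
  apply Subtype.ext
  rw [Subgroup.coe_mul]
  unfold endoCircle
  have hz : (![Circle.exp ((c + c') w 1)] : Fin 1 → Circle) = ![Circle.exp (c w 1)] * ![Circle.exp (c' w 1)] := by
    funext i
    fin_cases i; simp [Pi.add_apply, Circle.exp_add]
  simp only [hz, map_mul]

/-- The `U(Φ₂)_w`-block at `c = 0` is `1`. [cite: Rogawski1990, §3.6 p. 31] -/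
theorem endoBlock_zero (S : Finset {w : InfinitePlace L // IsComplex w}) (w : {w : InfinitePlace L // IsComplex w}) : endoBlock L S 0 w = 1 := by
  have h := endoBlock_add L S 0 0 w
  rw [add_zero] at h
  exact mul_eq_left.mp h.symm

/-- The `U(Φ₁)_w`-entry at `c = 0` is `1`. [cite: Rogawski1990, §4.9 p. 54] -/
theorem endoCircle_zero (w : {w : InfinitePlace L // IsComplex w}) : endoCircle L 0 w = 1 := by
  have h := endoCircle_add L 0 0 w
  rw [add_zero] at h
  exact mul_eq_left.mp h.symm

variable [NumberField L] [IsCMField L]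

/-- **THE CHART IS ADDITIVE**: `endoTorus S (c + c′) = endoTorus S c · endoTorus S c′` (place components multiply; ★ `archPiEquivCM⁻¹` is a homomorphism).
[cite: Rogawski1990, §3.6 p. 31; §8.2 p. 122] [cite: Shelstad1979, §4 p. 22] -/
theorem endoTorus_add (S : Finset {w : InfinitePlace L // IsComplex w}) (c c' : {w : InfinitePlace L // IsComplex w} → Fin 3 → ℝ) :
    endoTorus L S (c + c') = endoTorus L S c * endoTorus L S c' := by
  have h1 : endoBlock L S (c + c') = endoBlock L S c * endoBlock L S c' := funext fun w => endoBlock_add L S c c' w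
  have h2 : endoCircle L (c + c') = endoCircle L c * endoCircle L c' := funext fun w => endoCircle_add L c c' w
  unfold endoTorus
  rw [h1, h2, map_mul, map_mul]
  rfl

/-- `endoTorus S 0 = 1`. [cite: Rogawski1990, §3.6 p. 31] -/
theorem endoTorus_zero (S : Finset {w : InfinitePlace L // IsComplex w}) : endoTorus L S 0 = 1 := by
  have h := endoTorus_add L S 0 0
  rw [add_zero] at h
  exact mul_eq_left.mp h.symm

/-- `endoTorus S (−c) = (endoTorus S c)⁻¹`. [cite: Rogawski1990, §3.6 p. 31] -/
theorem endoTorus_neg (S : Finset {w : InfinitePlace L // IsComplex w}) (c : {w : InfinitePlace L // IsComplex w} → Fin 3 → ℝ) :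
    endoTorus L S (-c) = (endoTorus L S c)⁻¹ := by
  have h := endoTorus_add L S c (-c)
  rw [add_neg_cancel, endoTorus_zero] at h
  exact (eq_inv_of_mul_eq_one_right h.symm)

/-- `endoTorus S (c − c′) = endoTorus S c · (endoTorus S c′)⁻¹`. [cite: Rogawski1990, §3.6 p. 31] -/
theorem endoTorus_sub (S : Finset {w : InfinitePlace L // IsComplex w}) (c c' : {w : InfinitePlace L // IsComplex w} → Fin 3 → ℝ) :
    endoTorus L S (c - c') = endoTorus L S c * (endoTorus L S c')⁻¹ := by
  rw [sub_eq_add_neg, endoTorus_add, endoTorus_neg]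

/-- **Chart points commute** (the coordinate space is abelian). [cite: Rogawski1990, §3.6 p. 31] -/
theorem endoTorus_comm (S : Finset {w : InfinitePlace L // IsComplex w}) (c c' : {w : InfinitePlace L // IsComplex w} → Fin 3 → ℝ) :
    endoTorus L S c * endoTorus L S c' = endoTorus L S c' * endoTorus L S c := by
  rw [← endoTorus_add, ← endoTorus_add, add_comm]

/-- **The chart as a monoid homomorphism** `Multiplicative (W → Fin 3 → ℝ) →* H_∞`. [cite: Rogawski1990, §3.6 p. 31] [cite: Shelstad1979, §4 p. 22] -/
def endoTorusHom (S : Finset {w : InfinitePlace L // IsComplex w}) :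
    Multiplicative ({w : InfinitePlace L // IsComplex w} → Fin 3 → ℝ) →*
      ↥(arch (↥(maximalRealSubfield L)) L (IsCMField.complexConj L) 2 (Matrix.of fun i j : Fin 2 => if i.val + j.val + 1 = 2 then (1 : L) else 0)) ×
        ↥(arch (↥(maximalRealSubfield L)) L (IsCMField.complexConj L) 1 (Matrix.of fun i j : Fin 1 => if i.val + j.val + 1 = 1 then (1 : L) else 0)) where
  toFun c := endoTorus L S (Multiplicative.toAdd c)
  map_one' := endoTorus_zero L S
  map_mul' a b := endoTorus_add L S (Multiplicative.toAdd a) (Multiplicative.toAdd b)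

/-- `endoTorusHom S (ofAdd c) = endoTorus S c` (definitional). [cite: Rogawski1990, §3.6 p. 31] -/
@[simp] theorem endoTorusHom_apply (S : Finset {w : InfinitePlace L // IsComplex w}) (c : Multiplicative ({w : InfinitePlace L // IsComplex w} → Fin 3 → ℝ)) :
    endoTorusHom L S c = endoTorus L S (Multiplicative.toAdd c) := rfl

end Hom

/-! ## §2 The chart torus `T_S ≤ H_∞` -/

section Torus

variable (L : Type) [Field L] [NumberField L] [IsCMField L] (S : Finset {w : InfinitePlace L // IsComplex w})

/-- **The chart torus `T_S ≤ H_∞` of the Cartan class `S`** — the (closure of the) image of the chart `c ↦ endoTorus S c`: split at `w ∈ S`, compact at `w ∉ S`,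
times the `U(Φ₁)`-circles.  (The image is closed — a Cartan subgroup, `= Z(endoTorus S c)` at regular `c`, (T-ATLAS) PART 2 — so this IS the image; the closure only
makes `IsClosed` definitionally available.) [cite: Rogawski1990, §3.6 p. 31; §8.2 p. 122] [cite: Shelstad1979, §4 p. 22] -/
def chartTorusH :
    Subgroup (↥(arch (↥(maximalRealSubfield L)) L (IsCMField.complexConj L) 2 (Matrix.of fun i j : Fin 2 => if i.val + j.val + 1 = 2 then (1 : L) else 0)) ×
      ↥(arch (↥(maximalRealSubfield L)) L (IsCMField.complexConj L) 1 (Matrix.of fun i j : Fin 1 => if i.val + j.val + 1 = 1 then (1 : L) else 0))) :=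
  (endoTorusHom L S).range.topologicalClosure

/-- `T_S` is closed. [cite: Shelstad1979, §4 p. 22] -/
theorem isClosed_chartTorusH :
    IsClosed (chartTorusH L S : Set (↥(arch (↥(maximalRealSubfield L)) L (IsCMField.complexConj L) 2 (Matrix.of fun i j : Fin 2 => if i.val + j.val + 1 = 2 then (1 : L) else 0)) ×
      ↥(arch (↥(maximalRealSubfield L)) L (IsCMField.complexConj L) 1 (Matrix.of fun i j : Fin 1 => if i.val + j.val + 1 = 1 then (1 : L) else 0)))) :=
  Subgroup.isClosed_topologicalClosure _

/-- The range of the chart lies in `T_S`. [cite: Rogawski1990, §3.6 p. 31] -/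
theorem range_endoTorusHom_le_chartTorusH : (endoTorusHom L S).range ≤ chartTorusH L S :=
  Subgroup.le_topologicalClosure _

/-- **Every chart point lies in `T_S`.** [cite: Rogawski1990, §3.6 p. 31; §8.2 p. 122] -/
theorem endoTorus_mem_chartTorusH (c : {w : InfinitePlace L // IsComplex w} → Fin 3 → ℝ) : endoTorus L S c ∈ chartTorusH L S :=
  range_endoTorusHom_le_chartTorusH L S ⟨Multiplicative.ofAdd c, rfl⟩

/-- The centraliser of a point is closed (the equation `h t = t h`). [folklore] -/
private theorem isClosed_centralizer_singleton' {G : Type*} [Group G] [TopologicalSpace G] [IsTopologicalGroup G] [T2Space G] (t : G) :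
    IsClosed (Subgroup.centralizer ({t} : Set G) : Set G) := by
  have h : (Subgroup.centralizer ({t} : Set G) : Set G) = {g : G | t * g = g * t} := by
    ext g
    simp [Subgroup.mem_centralizer_iff]
  rw [h]
  exact isClosed_eq (continuous_const.mul continuous_id) (continuous_id.mul continuous_const)

/-- **`T_S ≤ Z(endoTorus S c)` for EVERY `c`**: the range commutes with each chart point (`endoTorus_comm`) and centralisers are closed.  (Equality for `c ∈ RegG S` is
(T-ATLAS) PART 2's centraliser lemma.) [cite: Rogawski1990, §3.6 p. 31] [cite: Shelstad1979, §4 p. 22] -/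
theorem chartTorusH_le_centralizer (c : {w : InfinitePlace L // IsComplex w} → Fin 3 → ℝ) :
    chartTorusH L S ≤ Subgroup.centralizer ({endoTorus L S c} : Set _) := by
  refine Subgroup.topologicalClosure_minimal _ ?_ (isClosed_centralizer_singleton' _)
  rintro _ ⟨a, rfl⟩
  rw [Subgroup.mem_centralizer_iff]
  rintro _ rfl
  rw [endoTorusHom_apply]
  exact endoTorus_comm L S c _

/-- **Every element of `T_S` commutes with every chart point** — the well-definedness binder of the orbital integrand ★ `descConj (endoTorus S c) T_S _`, for ALL `c`.
[cite: Rogawski1990, §8.2 p. 122] [cite: Shelstad1979, §4 p. 22] -/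
theorem forall_mem_chartTorusH_comm (c : {w : InfinitePlace L // IsComplex w} → Fin 3 → ℝ) :
    ∀ m ∈ chartTorusH L S, m * endoTorus L S c = endoTorus L S c * m := fun _ hm =>
  ((Subgroup.mem_centralizer_iff.mp (chartTorusH_le_centralizer L S c hm)) _ rfl).symm

/-- The range of the chart is commutative. [cite: Rogawski1990, §3.6 p. 31] -/
theorem range_endoTorusHom_mul_comm (a b : ↥(endoTorusHom L S).range) : a * b = b * a := by
  obtain ⟨a, x, rfl⟩ := a
  obtain ⟨b, y, rfl⟩ := b
  apply Subtype.ext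
  simp only [Subgroup.coe_mul, endoTorusHom_apply]
  exact endoTorus_comm L S _ _

/-- **`T_S` is abelian.** [cite: Rogawski1990, §3.6 p. 31] [cite: Shelstad1979, §4 p. 22] -/
theorem chartTorusH_mul_comm (a b : ↥(chartTorusH L S)) : a * b = b * a :=
  (Subgroup.commGroupTopologicalClosure (endoTorusHom L S).range (range_endoTorusHom_mul_comm L S)).mul_comm a b

/-- `T_S` is locally compact (closed in the locally compact `H_∞`). [cite: Folland1995, §2.2] -/
theorem locallyCompactSpace_chartTorusH : LocallyCompactSpace ↥(chartTorusH L S) :=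
  (isClosed_chartTorusH L S).isClosedEmbedding_subtypeVal.locallyCompactSpace

/-- The chart orbital integrand `y T_S ↦ fH (y · endoTorus S c · y⁻¹)` is continuous for continuous `fH` (and jointly in `(c, ȳ)`: ★ `continuous_descConj_prod` with
`continuous_endoTorus`). [cite: Rogawski1990, §8.3 p. 124] -/
theorem continuous_descConj_endoTorus {Y : Type*} [TopologicalSpace Y]
    (fH : ↥(arch (↥(maximalRealSubfield L)) L (IsCMField.complexConj L) 2 (Matrix.of fun i j : Fin 2 => if i.val + j.val + 1 = 2 then (1 : L) else 0)) ×
      ↥(arch (↥(maximalRealSubfield L)) L (IsCMField.complexConj L) 1 (Matrix.of fun i j : Fin 1 => if i.val + j.val + 1 = 1 then (1 : L) else 0)) → Y)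
    (hfH : Continuous fH) (c : {w : InfinitePlace L // IsComplex w} → Fin 3 → ℝ) :
    Continuous (descConj (endoTorus L S c) (chartTorusH L S) (forall_mem_chartTorusH_comm L S c) fH) := by
  rw [(QuotientGroup.isQuotientMap_mk _).continuous_iff, descConj_comp_mk]
  exact hfH.comp ((continuous_id.mul continuous_const).mul continuous_id.inv)

omit [NumberField L] [IsCMField L] in
/-- **The closed coordinate box of the chart `S`**: `x_w ∈ [0, 1]` in the split slot (`w ∈ S`, slot `0`), every other (angle) slot in `[0, 2π]` — a compact
fundamental box for the periods of the chart (PACK-SPEC (δ3)). [cite: Rogawski1990, §8.2 p. 122] [cite: Folland1995, §2.2] -/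
def chartBox : Set ({w : InfinitePlace L // IsComplex w} → Fin 3 → ℝ) :=
  Set.pi Set.univ fun w => Set.pi Set.univ fun i => Set.Icc 0 (if w ∈ S ∧ i = 0 then 1 else 2 * Real.pi)

omit [NumberField L] [IsCMField L] in
/-- The coordinate box is compact. [cite: Folland1995, §2.2] -/
theorem isCompact_chartBox : IsCompact (chartBox L S) :=
  isCompact_univ_pi fun _ => isCompact_univ_pi fun _ => isCompact_Icc

omit [NumberField L] [IsCMField L] in
/-- `0` lies in the coordinate box. [cite: Folland1995, §2.2] -/
theorem zero_mem_chartBox : (0 : {w : InfinitePlace L // IsComplex w} → Fin 3 → ℝ) ∈ chartBox L S := by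
  intro w _ i _
  simp only [Pi.zero_apply, Set.mem_Icc, le_refl, true_and]
  split_ifs
  · exact zero_le_one
  · positivity

/-- **The box image `B_S ⊆ T_S`**: the image of the closed coordinate box under the chart — the compact set whose Haar mass normalises the chart orbital functional
(PACK-SPEC (δ3): `chartOrbH` carries the prefactor `dt_S(B_S)`, which makes it independent of the choice of `dt_S`). [cite: Rogawski1990, §8.2 p. 122] [cite: Folland1995, §2.2] -/
def chartBoxImg : Set ↥(chartTorusH L S) :=
  (fun c => (⟨endoTorus L S c, endoTorus_mem_chartTorusH L S c⟩ : ↥(chartTorusH L S))) '' chartBox L S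

/-- `B_S` is compact (continuous image of the compact box). [cite: Folland1995, §2.2] -/
theorem isCompact_chartBoxImg : IsCompact (chartBoxImg L S) :=
  (isCompact_chartBox L S).image ((continuous_endoTorus L S).subtype_mk _)

/-- `1 ∈ B_S` (the image of `c = 0`). [cite: Folland1995, §2.2] -/
theorem one_mem_chartBoxImg : (1 : ↥(chartTorusH L S)) ∈ chartBoxImg L S :=
  ⟨0, zero_mem_chartBox L S, Subtype.ext (endoTorus_zero L S)⟩

end Torus

/-! ## §3 The Haar measure of the chart torus -/

section Haar

variable (L : Type) [Field L] [NumberField L] [IsCMField L] (S : Finset {w : InfinitePlace L // IsComplex w})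
  [MeasurableSpace (↥(arch (↥(maximalRealSubfield L)) L (IsCMField.complexConj L) 2 (Matrix.of fun i j : Fin 2 => if i.val + j.val + 1 = 2 then (1 : L) else 0)) ×
      ↥(arch (↥(maximalRealSubfield L)) L (IsCMField.complexConj L) 1 (Matrix.of fun i j : Fin 1 => if i.val + j.val + 1 = 1 then (1 : L) else 0)))]
  [BorelSpace (↥(arch (↥(maximalRealSubfield L)) L (IsCMField.complexConj L) 2 (Matrix.of fun i j : Fin 2 => if i.val + j.val + 1 = 2 then (1 : L) else 0)) ×
      ↥(arch (↥(maximalRealSubfield L)) L (IsCMField.complexConj L) 1 (Matrix.of fun i j : Fin 1 => if i.val + j.val + 1 = 1 then (1 : L) else 0)))]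

/-- **THE (AUXILIARY) HAAR MEASURE `dt_S` OF THE CHART TORUS `T_S`** — Mathlib's Haar measure of the locally compact abelian group `T_S` at a fixed positive compact (the
σ-algebra on `T_S` is the one induced from `H_∞`, i.e. Borel).  AUXILIARY: consumers read `chartOrbH`, which carries the prefactor `dt_S(B_S)` and is therefore
independent of this choice (PACK-SPEC (δ3); the Haar-freeness lemma `chartOrbH_eq_of_isHaarMeasure` is the sibling THEOREMS file).
[cite: Folland1995, §2.2; §2.6 (2.52)] [cite: Shelstad1979, §4 p. 22] -/
def chartHaarH : Measure ↥(chartTorusH L S) :=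
  haveI := locallyCompactSpace_chartTorusH L S
  haarMeasure (Classical.arbitrary (TopologicalSpace.PositiveCompacts ↥(chartTorusH L S)))

/-- `dt_S` is a Haar measure. [cite: Folland1995, §2.2] -/
theorem isHaarMeasure_chartHaarH : (chartHaarH L S).IsHaarMeasure := by
  haveI := locallyCompactSpace_chartTorusH L S
  unfold chartHaarH
  infer_instance

/-- `dt_S` is regular. [cite: Folland1995, §2.2] -/
theorem regular_chartHaarH : (chartHaarH L S).Regular := by
  haveI := locallyCompactSpace_chartTorusH L S
  unfold chartHaarH
  infer_instance

/-- `dt_S` is left invariant. [cite: Folland1995, §2.2] -/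
theorem isMulLeftInvariant_chartHaarH : (chartHaarH L S).IsMulLeftInvariant :=
  haveI := isHaarMeasure_chartHaarH L S
  inferInstance

/-- `dt_S` is finite on compact sets. [cite: Folland1995, §2.2] -/
theorem isFiniteMeasureOnCompacts_chartHaarH : IsFiniteMeasureOnCompacts (chartHaarH L S) :=
  haveI := isHaarMeasure_chartHaarH L S
  inferInstance

/-- `dt_S` is positive on open sets. [cite: Folland1995, §2.2] -/
theorem isOpenPosMeasure_chartHaarH : (chartHaarH L S).IsOpenPosMeasure :=
  haveI := isHaarMeasure_chartHaarH L S
  inferInstance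

/-- `dt_S(B_S) < ∞` (compact). [cite: Folland1995, §2.2] -/
theorem chartHaarH_chartBoxImg_lt_top : chartHaarH L S (chartBoxImg L S) < ⊤ :=
  haveI := isHaarMeasure_chartHaarH L S
  (isCompact_chartBoxImg L S).measure_lt_top

/-- **`dt_S` is inversion invariant** (`T_S` is abelian; Mathlib `IsHaarMeasure.isInvInvariant_of_regular`) — the unimodularity binder of ★ `quotientMeasure`.
[cite: Folland1995, §2.2; §2.6 Thm. 2.49] -/
theorem isInvInvariant_chartHaarH : (chartHaarH L S).IsInvInvariant := by
  haveI := locallyCompactSpace_chartTorusH L S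
  haveI := isHaarMeasure_chartHaarH L S
  haveI := regular_chartHaarH L S
  letI : CommGroup ↥(chartTorusH L S) := { (inferInstance : Group ↥(chartTorusH L S)) with mul_comm := chartTorusH_mul_comm L S }
  exact IsHaarMeasure.isInvInvariant_of_regular (chartHaarH L S)

end Haar

/-! ## §4 The chart quotient measure and the chart orbital functional `chartOrbH` -/

section Orb

variable (L : Type) [Field L] [NumberField L] [IsCMField L]
  [MeasurableSpace (↥(arch (↥(maximalRealSubfield L)) L (IsCMField.complexConj L) 2 (Matrix.of fun i j : Fin 2 => if i.val + j.val + 1 = 2 then (1 : L) else 0)) ×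
      ↥(arch (↥(maximalRealSubfield L)) L (IsCMField.complexConj L) 1 (Matrix.of fun i j : Fin 1 => if i.val + j.val + 1 = 1 then (1 : L) else 0)))]
  [BorelSpace (↥(arch (↥(maximalRealSubfield L)) L (IsCMField.complexConj L) 2 (Matrix.of fun i j : Fin 2 => if i.val + j.val + 1 = 2 then (1 : L) else 0)) ×
      ↥(arch (↥(maximalRealSubfield L)) L (IsCMField.complexConj L) 1 (Matrix.of fun i j : Fin 1 => if i.val + j.val + 1 = 1 then (1 : L) else 0)))]
  (νH : Measure (↥(arch (↥(maximalRealSubfield L)) L (IsCMField.complexConj L) 2 (Matrix.of fun i j : Fin 2 => if i.val + j.val + 1 = 2 then (1 : L) else 0)) ×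
      ↥(arch (↥(maximalRealSubfield L)) L (IsCMField.complexConj L) 1 (Matrix.of fun i j : Fin 1 => if i.val + j.val + 1 = 1 then (1 : L) else 0))))
  [IsFiniteMeasureOnCompacts νH] [νH.IsMulRightInvariant]
  (S : Finset {w : InfinitePlace L // IsComplex w})

/-- **THE CHART QUOTIENT MEASURE `dνH ∕ dt_S` on `H_∞ ⧸ T_S`** (★ `quotientMeasure`, Deitmar–Echterhoff Thm. 1.5.3; the quotient carries its Borel σ-algebra).
[cite: DeitmarEchterhoff2014, Thm. 1.5.3] [cite: Folland1995, §2.6 Thm. 2.49] -/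
def chartQuotientMeasureH :
    @Measure ((↥(arch (↥(maximalRealSubfield L)) L (IsCMField.complexConj L) 2 (Matrix.of fun i j : Fin 2 => if i.val + j.val + 1 = 2 then (1 : L) else 0)) ×
      ↥(arch (↥(maximalRealSubfield L)) L (IsCMField.complexConj L) 1 (Matrix.of fun i j : Fin 1 => if i.val + j.val + 1 = 1 then (1 : L) else 0))) ⧸ chartTorusH L S)
      (borel _) := by
  letI : MeasurableSpace ((↥(arch (↥(maximalRealSubfield L)) L (IsCMField.complexConj L) 2 (Matrix.of fun i j : Fin 2 => if i.val + j.val + 1 = 2 then (1 : L) else 0)) ×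
      ↥(arch (↥(maximalRealSubfield L)) L (IsCMField.complexConj L) 1 (Matrix.of fun i j : Fin 1 => if i.val + j.val + 1 = 1 then (1 : L) else 0))) ⧸ chartTorusH L S) := borel _
  haveI : BorelSpace ((↥(arch (↥(maximalRealSubfield L)) L (IsCMField.complexConj L) 2 (Matrix.of fun i j : Fin 2 => if i.val + j.val + 1 = 2 then (1 : L) else 0)) ×
      ↥(arch (↥(maximalRealSubfield L)) L (IsCMField.complexConj L) 1 (Matrix.of fun i j : Fin 1 => if i.val + j.val + 1 = 1 then (1 : L) else 0))) ⧸ chartTorusH L S) := ⟨rfl⟩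
  haveI := isMulLeftInvariant_chartHaarH L S
  haveI := isFiniteMeasureOnCompacts_chartHaarH L S
  haveI := isOpenPosMeasure_chartHaarH L S
  haveI := isInvInvariant_chartHaarH L S
  exact quotientMeasure (chartTorusH L S) (chartHaarH L S) (isClosed_chartTorusH L S) νH

/-- **THE CHART ORBITAL FUNCTIONAL** `chartOrbH νH S fH c := dt_S(B_S) · ∫_{H_∞ ⧸ T_S} fH (y · endoTorus S c · y⁻¹) d(dνH ∕ dt_S)(ȳ)` (★ `descConj`), defined at EVERY
coordinate `c` (chart points commute with `T_S`).  The prefactor `dt_S(B_S)` (Haar mass of the box image) makes the functional INDEPENDENT of the Haar measure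
`dt_S` (`t ↦ κ t` multiplies the box mass by `κ` and the quotient measure by `κ⁻¹`; PACK-SPEC (δ3), lemma `chartOrbH_eq_of_isHaarMeasure` in the sibling file); at
regular `c` it is the Weil-form orbital integral of `fH` at `endoTorus S c` up to the (CUR) density scalar.
[cite: Rogawski1990, §8.2 p. 122; §8.3 p. 124] [cite: Shelstad1979, §4 p. 22] [cite: DeitmarEchterhoff2014, Thm. 1.5.3] -/
def chartOrbH
    (fH : ↥(arch (↥(maximalRealSubfield L)) L (IsCMField.complexConj L) 2 (Matrix.of fun i j : Fin 2 => if i.val + j.val + 1 = 2 then (1 : L) else 0)) ×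
      ↥(arch (↥(maximalRealSubfield L)) L (IsCMField.complexConj L) 1 (Matrix.of fun i j : Fin 1 => if i.val + j.val + 1 = 1 then (1 : L) else 0)) → ℂ)
    (c : {w : InfinitePlace L // IsComplex w} → Fin 3 → ℝ) : ℂ := by
  letI : MeasurableSpace ((↥(arch (↥(maximalRealSubfield L)) L (IsCMField.complexConj L) 2 (Matrix.of fun i j : Fin 2 => if i.val + j.val + 1 = 2 then (1 : L) else 0)) ×
      ↥(arch (↥(maximalRealSubfield L)) L (IsCMField.complexConj L) 1 (Matrix.of fun i j : Fin 1 => if i.val + j.val + 1 = 1 then (1 : L) else 0))) ⧸ chartTorusH L S) := borel _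
  exact ((chartHaarH L S (chartBoxImg L S)).toReal : ℂ) *
    ∫ y, descConj (endoTorus L S c) (chartTorusH L S) (forall_mem_chartTorusH_comm L S c) fH y ∂(chartQuotientMeasureH L νH S)

/-- `chartOrbH` unfolded (definitional). [cite: Rogawski1990, §8.2 p. 122] -/
theorem chartOrbH_def
    (fH : ↥(arch (↥(maximalRealSubfield L)) L (IsCMField.complexConj L) 2 (Matrix.of fun i j : Fin 2 => if i.val + j.val + 1 = 2 then (1 : L) else 0)) ×
      ↥(arch (↥(maximalRealSubfield L)) L (IsCMField.complexConj L) 1 (Matrix.of fun i j : Fin 1 => if i.val + j.val + 1 = 1 then (1 : L) else 0)) → ℂ)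
    (c : {w : InfinitePlace L // IsComplex w} → Fin 3 → ℝ) :
    chartOrbH L νH S fH c =
      (letI : MeasurableSpace ((↥(arch (↥(maximalRealSubfield L)) L (IsCMField.complexConj L) 2 (Matrix.of fun i j : Fin 2 => if i.val + j.val + 1 = 2 then (1 : L) else 0)) ×
          ↥(arch (↥(maximalRealSubfield L)) L (IsCMField.complexConj L) 1 (Matrix.of fun i j : Fin 1 => if i.val + j.val + 1 = 1 then (1 : L) else 0))) ⧸ chartTorusH L S) := borel _
       ((chartHaarH L S (chartBoxImg L S)).toReal : ℂ) *
         ∫ y, descConj (endoTorus L S c) (chartTorusH L S) (forall_mem_chartTorusH_comm L S c) fH y ∂(chartQuotientMeasureH L νH S)) := rfl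

/-- **`chartOrbH` depends on `c` only through the chart point `endoTorus S c`** — so every coordinate change fixing the chart point (the `2π`-periods of the angle
slots, ★ atlas) fixes `chartOrbH` ((P) of the D2-pack is one line over this). [cite: Rogawski1990, §8.2 p. 122] -/
theorem chartOrbH_congr
    (fH : ↥(arch (↥(maximalRealSubfield L)) L (IsCMField.complexConj L) 2 (Matrix.of fun i j : Fin 2 => if i.val + j.val + 1 = 2 then (1 : L) else 0)) ×
      ↥(arch (↥(maximalRealSubfield L)) L (IsCMField.complexConj L) 1 (Matrix.of fun i j : Fin 1 => if i.val + j.val + 1 = 1 then (1 : L) else 0)) → ℂ)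
    {c c' : {w : InfinitePlace L // IsComplex w} → Fin 3 → ℝ} (h : endoTorus L S c = endoTorus L S c') :
    chartOrbH L νH S fH c = chartOrbH L νH S fH c' := by
  rw [chartOrbH_def, chartOrbH_def]
  have hint : descConj (endoTorus L S c) (chartTorusH L S) (forall_mem_chartTorusH_comm L S c) fH =
      descConj (endoTorus L S c') (chartTorusH L S) (forall_mem_chartTorusH_comm L S c') fH := by
    funext y
    induction y using QuotientGroup.induction_on with
    | H g => rw [descConj_mk, descConj_mk, h]
  rw [hint]

/-- `chartOrbH νH S 0 c = 0`. [cite: Rogawski1990, §8.2 p. 122] -/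
theorem chartOrbH_zero (c : {w : InfinitePlace L // IsComplex w} → Fin 3 → ℝ) : chartOrbH L νH S 0 c = 0 := by
  rw [chartOrbH_def]
  have h : descConj (endoTorus L S c) (chartTorusH L S) (forall_mem_chartTorusH_comm L S c)
      (0 : ↥(arch (↥(maximalRealSubfield L)) L (IsCMField.complexConj L) 2 (Matrix.of fun i j : Fin 2 => if i.val + j.val + 1 = 2 then (1 : L) else 0)) ×
        ↥(arch (↥(maximalRealSubfield L)) L (IsCMField.complexConj L) 1 (Matrix.of fun i j : Fin 1 => if i.val + j.val + 1 = 1 then (1 : L) else 0)) → ℂ) = 0 := by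
    funext y
    induction y using QuotientGroup.induction_on
    rfl
  rw [h]
  simp only [Pi.zero_apply, integral_zero, mul_zero]

end Orb

end Literature.NumberTheory.Automorphic.UnitaryGroup

end
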